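import Mathlib
import HarnessLib
import Literature.Analysis.FluidPDE.RadialCalculus
import Summits.NavierStokesRegularity.NavierStokesRegularity.Theorems.UnthreadedDoorAntidynamoSphereConstancy
import Summits.NavierStokesRegularity.NavierStokesRegularity.Theorems.UnthreadedDoorAntidynamoVorticityStructure
import Summits.NavierStokesRegularity.NavierStokesRegularity.Theorems.UnthreadedDoorAntidynamoHarmonicRadialPower

/-!
# Route `UnthreadedDoor` / `ThreadingFlux`, crux `PoloidalLiouville` (stmt-NavierStokesRegularity-1222), antidynamo v2 skeleton
# (sha16 `4ebf5683127b`), rung `stub_singleDegreeRung` (BC5): NON-DEGENERACY OF HARMONIC HOMOGENEOUS PROFILES (profile geometry, 2/2) —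
# the two remaining profile hypotheses of step S2 (`…AntidynamoVorticityStructure.exists_analytic_coeff_curl_eq`)

Support file (seat leafhand-ns-unthreadeddoor-1 g0, cell decomp-ns), `--supports stmt-NavierStokesRegularity-1222 --as helper`; theorems only.
For a `C^ω`, positively homogeneous (degree `l ≥ 1`), HARMONIC profile `Q : ℝ³ → ℝ` that is not identically zero:

* ★ `exists_cross_gradient_ne_zero_of_isOpen` — `Λ = ∇Q × id` is non-zero somewhere in every nonempty open set (else `Λ ≡ 0` by
  analyticity, `Q` is constant on spheres (`…AntidynamoSphereConstancy`), `Q = c ‖y‖ˡ` by homogeneity, and `c = 0` by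
  `…AntidynamoHarmonicRadialPower`, so `Q ≡ 0`);
* ★ `exists_near_ne_on_sphere` — `Q` restricted to the unit sphere is nowhere locally constant (else `Q = c ‖y‖ˡ` on an open cone,
  `∇Q` is radial there by the radial-calculus lemma `hasFDerivAt_comp_norm_sq`, and `Λ` vanishes on an open set).

HONEST LABEL: elementary profile geometry for the plan-only rung; nothing here bears on `PoloidalLiouville` (1222) or NS regularity. [folklore]
-/

noncomputable section

-- the summit and its single sub-problem share the name (CONVENTIONS §1)
set_option linter.dupNamespace false

open scoped Topology InnerProductSpace RealInnerProductSpace ContDiff Laplacian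
open Filter Set Function Metric
open Literature.Analysis.FluidPDE

namespace Summit.NavierStokesRegularity.NavierStokesRegularity.Theorems.PoloidalLiouville.Antidynamo

/-- ★ `Λ = ∇Q × id` IS NON-ZERO DENSELY for a non-zero harmonic positively homogeneous `C^ω` profile of degree `l ≥ 1`: every nonempty
open set contains a point where `Λ ≠ 0` (else `Λ ≡ 0` by analyticity, `Q` is radial, `Q = c ‖y‖ˡ`, `c = 0`, `Q ≡ 0`). [folklore] -/
theorem exists_cross_gradient_ne_zero_of_isOpen {Q : EuclideanSpace ℝ (Fin 3) → ℝ} (hQ : ContDiff ℝ ω Q) {l : ℕ} (hl : 1 ≤ l)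
    (hhom : ∀ r : ℝ, 0 < r → ∀ y : EuclideanSpace ℝ (Fin 3), Q (r • y) = r ^ l * Q y)
    (hharm : ∀ y, (Δ Q) y = 0) (hne : ∃ y, Q y ≠ 0)
    {W : Set (EuclideanSpace ℝ (Fin 3))} (hW : IsOpen W) (hWne : W.Nonempty) :
    ∃ y ∈ W, cross (gradient Q y) y ≠ 0 := by
  by_contra hcon
  push Not at hcon
  have hΛan : AnalyticOnNhd ℝ (fun y : EuclideanSpace ℝ (Fin 3) => cross (gradient Q y) y) univ :=
    fun y _ => (contDiff_omega_cross_gradient hQ).contDiffAt.analyticAt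
  obtain ⟨z₀, hz₀⟩ := hWne
  have hev : (fun y : EuclideanSpace ℝ (Fin 3) => cross (gradient Q y) y) =ᶠ[𝓝 z₀] 0 := by
    filter_upwards [hW.mem_nhds hz₀] with y hy using hcon y hy
  have hzero := hΛan.eqOn_zero_of_preconnected_of_eventuallyEq_zero isPreconnected_univ (mem_univ z₀) hev
  have hrad : ∀ y, cross (gradient Q y) y = 0 := fun y => hzero (mem_univ y)
  have hQd : Differentiable ℝ Q := hQ.differentiable (by simp)
  have hform := eq_mul_norm_pow_of_cross_gradient_eq_zero hQd hhom hrad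
  have hc : Q (EuclideanSpace.single 0 1) = 0 := eq_zero_of_laplacian_eq_zero_of_eq_mul_norm_pow hl hharm hform
  obtain ⟨y, hy⟩ := hne
  apply hy
  by_cases hy0 : y = 0
  · rw [hy0]; exact eq_zero_at_zero_of_homogeneous hl hhom
  · rw [hform y hy0, hc, zero_mul]

/-- ★ `Q|_{S²}` IS NOWHERE LOCALLY CONSTANT for a non-zero harmonic positively homogeneous `C^ω` profile of degree `l ≥ 1`: near every
unit vector there are unit vectors with a different value (else `Q = c ‖y‖ˡ` on an open cone, `∇Q` is radial there, and `Λ` vanishes on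
an open set). [folklore] -/
theorem exists_near_ne_on_sphere {Q : EuclideanSpace ℝ (Fin 3) → ℝ} (hQ : ContDiff ℝ ω Q) {l : ℕ} (hl : 1 ≤ l)
    (hhom : ∀ r : ℝ, 0 < r → ∀ y : EuclideanSpace ℝ (Fin 3), Q (r • y) = r ^ l * Q y)
    (hharm : ∀ y, (Δ Q) y = 0) (hne : ∃ y, Q y ≠ 0)
    (θ : EuclideanSpace ℝ (Fin 3)) (hθ : ‖θ‖ = 1) (ε : ℝ) (hε : 0 < ε) :
    ∃ θ' : EuclideanSpace ℝ (Fin 3), ‖θ'‖ = 1 ∧ ‖θ' - θ‖ < ε ∧ Q θ' ≠ Q θ := by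
  by_contra hcon
  push Not at hcon
  have hθ0 : θ ≠ 0 := by rw [← norm_ne_zero_iff, hθ]; exact one_ne_zero
  -- the open cone `C = {y ≠ 0 : ‖y/‖y‖ − θ‖ < ε}`
  set π : EuclideanSpace ℝ (Fin 3) → EuclideanSpace ℝ (Fin 3) := fun y => (1 / ‖y‖) • y with hπ
  have hπc : ContinuousOn π {y | y ≠ 0} := fun y hy => (contDiffAt_radialProj 1 (n := 0) hy).continuousAt.continuousWithinAt
  set C : Set (EuclideanSpace ℝ (Fin 3)) := {y | y ≠ 0} ∩ π ⁻¹' ball θ ε with hC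
  have hCo : IsOpen C := hπc.isOpen_inter_preimage isOpen_ne isOpen_ball
  have hπθ : π θ = θ := by rw [hπ]; simp [hθ]
  have hθC : θ ∈ C := ⟨hθ0, by rw [mem_preimage, hπθ]; exact mem_ball_self hε⟩
  have hQC : ∀ y ∈ C, Q y = Q θ * ‖y‖ ^ l := by
    intro y hy
    have hn : 0 < ‖y‖ := norm_pos_iff.2 hy.1
    have hπ1 : ‖π y‖ = 1 := by rw [hπ]; simp only; rw [norm_radialProj hy.1, abs_one]
    have hπy : Q (π y) = Q θ := by
      have hb : π y ∈ ball θ ε := hy.2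
      rw [mem_ball, dist_eq_norm] at hb
      exact hcon (π y) hπ1 hb
    have h1 : Q y = ‖y‖ ^ l * Q (π y) := by
      have h := hhom ‖y‖ hn (π y)
      have hππ : ‖y‖ • π y = y := by
        rw [hπ]; simp only; rw [smul_smul, one_div, mul_inv_cancel₀ hn.ne', one_smul]
      rw [hππ] at h
      exact h
    rw [h1, hπy, mul_comm]
  have hΛC : ∀ y ∈ C, cross (gradient Q y) y = 0 := by
    intro y hy
    have hn : 0 < ‖y‖ := norm_pos_iff.2 hy.1
    set p : ℝ := (l : ℝ) / 2 with hp
    set g : ℝ → ℝ := fun σ => Q θ * σ ^ p with hg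
    have hev : Q =ᶠ[𝓝 y] fun w => g (‖w‖ ^ 2) := by
      filter_upwards [hCo.mem_nhds hy] with w hw
      rw [hQC w hw, hg]
      simp only
      congr 1
      rw [← Real.rpow_natCast ‖w‖ l, ← Real.rpow_natCast ‖w‖ 2, ← Real.rpow_mul (norm_nonneg w)]
      congr 1
      rw [hp]; push_cast; ring
    have hσ : 0 < ‖y‖ ^ 2 := by positivity
    have hgd : HasDerivAt g (Q θ * (p * (‖y‖ ^ 2) ^ (p - 1))) (‖y‖ ^ 2) :=
      (Real.hasDerivAt_rpow_const (Or.inl hσ.ne')).const_mul (Q θ)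
    have hG := hasFDerivAt_comp_norm_sq (E := EuclideanSpace ℝ (Fin 3)) hgd
    have hfd : fderiv ℝ Q y = (2 * (Q θ * (p * (‖y‖ ^ 2) ^ (p - 1)))) • innerSL ℝ y := by
      rw [hev.fderiv_eq, hG.fderiv]
    rw [gradient, hfd, toDual_symm_smul_innerSL, cross_smul_self_left]
  obtain ⟨y, hyC, hy⟩ := exists_cross_gradient_ne_zero_of_isOpen hQ hl hhom hharm hne hCo ⟨θ, hθC⟩
  exact hy (hΛC y hyC)

end Summit.NavierStokesRegularity.NavierStokesRegularity.Theorems.PoloidalLiouville.Antidynamo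

end
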